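import Summits.QuantumFields.BalabanUV.Beta.FP.TowerNSocketOfRow
import Summits.QuantumFields.BalabanUV.Beta.FP.KktCombRowShear

/-!
# `BalabanUV.Beta.FP.TowerNSocketOfRowShear` — road «FP» (binder row D1): v10's (S3-1)-N sockets `hXN ∕ hLN` AT THE RECORD **UNDER THE COMB-SHEARED ROW
# JUNCTION `hQN′`** — `𝔔₀ n B = (sn n) • 𝔔♭ n B + YN n B · P n B` («the SYM nested rows equal the centred-ROOTED composite rows through the N-slot up to the unit AND
# up to the comb rows' span»; road CORR-1 ∕ A-3 l.68907, an2 g79 A-4 l.68908: modulo v10's displays and the two non-degeneracies `hXN ∧ hLN ⟺ hQN′`)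

WHY (located).  `TowerNSocketOfRow` (v1.1) delivers `hXN_rec ∕ hLN_rec` under the EXACT row identity `hQN` (`𝔔₀ = (sn n)•𝔔♭`), which an2 W-7 refutes as stated for the
(III′) literal by reading (`bhKcomp`'s border is rooted, `𝔔₀`'s is (0.4)-SYM: they differ by `Dsh`'s coarse-gradient term at the coarse slots).  The block algebra of
CORR-1 (2) shows v10's own `hXN ∧ hLN` are EQUIVALENT to the weaker `hQN′` (difference in the span of the comb-indicator rows `P = bigP …`); `KktCombRowShear` is the
forward half typed.  THIS FILE composes: `XN := E(−YN)ᵀ · XNRec · E(−YN)` is a right inverse of `kkt H₀ [𝔔₀; P]` with v10's leg, from `hQN′` — so an END displaying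
`hQN′` instead of `hXN hLN` is EXACTLY as inhabited as v10 and names where (C1) lives.  Whether `hQN′` is inhabited by the literal is Engine C's ASK-2′ (an2 A-4:
expected NOT — then v10's `hLN` itself is not inhabited verbatim, a located finding for the referee; the END variant with `hQN′` is generated only on ASK-2′ ≤ 1e−10).

WHAT ([folklore] composition BY NAME; no `def`, no `def … : Prop`, nothing cited, 0 sorry): **`hXN_rec'`**, **`hLN_rec'`** — v10 L.223 ∕ L.229 CHARACTER FOR CHARACTER under
σ′ = {`(ρN n)` ↦ `(ctr (3 + 1) (Lc ^ (n + 1 + 1)))`, `((XN n) B)` ↦ `((E(−YN n B))ᵀ * XNRec Lc (fine Lc (Mc B)) (n + 1) (sn n) ((H₀ n) B) ((P n) B) ((fN n) B) * E(−YN n B))`},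
`E(Y) := fromBlocks 1 0 0 (fromBlocks 1 Y 0 1)` spelled out; from v10's displays `hsn hH₀ hP hfN`, `Odd Lc`, the data `YN` and the ONE hypothesis `hQN′`.

WHAT THIS IS NOT: `hQN′` is a HYPOTHESIS (the located (C1) row junction modulo the comb), NOT claimed, by value only; nothing of Bałaban's asserted, valued or discharged;
0 estimates; v10 + the END (v3, 52) NOT filed ∕ unchanged (policy); 0∕4 row-D1 binders (hW, hR, D1Tel, D1Rep); NOT (C1), NOT (T-ID), NOT D1, NEVER «G-an2-4 closed»,
NOT BetaPertH, NOT continuum, NOT Clay.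

HONEST DEPENDENCY (page 1, mandatory): continuum YM on T⁴ ⇐ BetaPertH ∧ nine spine estimates (0/9 proved); BetaPertH ⇐ (D1) ∧ (D4) ∧ CAP+tail;
G-an2-4 gates asym, D1 and NE2/3/4.  HONEST FRAMING (cell contract, verbatim): «discharging `BetaPertH` makes Bałaban's UV stability UNCONDITIONAL —
a real constructive-QFT result; it is NOT the continuum limit and NOT the Clay problem.»  ABSOLUTE RULE (cell charter, verbatim): «No internally-minted
statement may enter as a cited fact. Every hypothesis is either kernel-proved in this package or a verbatim quotation of a PUBLISHED theorem with page
reference. The manuscript(s) under audit are NOT citable for their own disputed steps — they are the thing under adjudication; programme-internal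
(2001/route/tribunal) claims are never citable.»  Road «FP» OWNER, b2b-balaban-beta-d1-p3 gen 57, 2026-08-29.  No existing file touched.
-/

noncomputable section

open scoped BigOperators Matrix

namespace Summit.QuantumFields.BalabanUV.Beta.FP.TowerNSocketOfRowShear

open Matrix Finset
open Literature.MathematicalPhysics.QuantumFieldTheory.Balaban1983to89
open Literature.MathematicalPhysics.QuantumFieldTheory.Balaban1983to89.Beta
open Literature.MathematicalPhysics.QuantumFieldTheory.Balaban1983to89.Beta.Composition (kkt)
open Literature.MathematicalPhysics.QuantumFieldTheory.Balaban1983to89.Beta.HessKerRate (scaleK)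
open B5Prop11Plancherel (fine)
open B6Lemma24Torus (pbox)
open AffineAveraging (Site box toSite)
open AveragingContoursRooted (ctr ctrOff ctrOff_mem_box)
open OneStepResolventKernel (Fib)
open Summit.QuantumFields.BalabanUV.Beta.AxialDressingRooted (axEc)
open Summit.QuantumFields.BalabanUV.Beta.BorderedHessian (stepScale)
open Summit.QuantumFields.BalabanUV.Beta.SymShiftedSpread (bhKStepSh)
open Summit.QuantumFields.BalabanUV.Beta.DshAn1 (Dsh)
open Summit.QuantumFields.BalabanUV.Beta.RelInvComposite (bhKcomp)
open Summit.QuantumFields.BalabanUV.Beta.CompositeOneShotJetData (Roots AN)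
open Summit.QuantumFields.BalabanUV.Beta.FP.KernelPeriodisationFib (Idx perF)
open Summit.QuantumFields.BalabanUV.Beta.FP.TorusCompositeObjects (towerTorus NParam bigP)
open Summit.QuantumFields.BalabanUV.Beta.FP.TorusGaugeCovariancePairing (wrapPt)
open Summit.QuantumFields.BalabanUV.Beta.GAN24.FineReadoutCauchyFrame (toSite_mem_range)
open Summit.QuantumFields.BalabanUV.Beta.FP.TowerNSocketOfRow (XNRec hXN_rec hLN_rec)
open Summit.QuantumFields.BalabanUV.Beta.FP.KktCombRowShear (rightInverse_of_shear leg_of_shear)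

variable (Lc : ℕ) [NeZero Lc] (hLc : Odd Lc) (Mc : ℕ → (Fin (3 + 1) → ℕ)) [∀ B μ, NeZero (Mc B μ)] (sn : ℕ → ℝ)
  (hsn : ∀ n : ℕ, sn n = ∏ ℓ ∈ range (n + 1 + 1), stepScale 3 Lc ℓ)
  {H₀ : ∀ n : ℕ, ∀ B : ℕ, Matrix (↥(pbox (towerTorus Lc (fine Lc (Mc B)) (n + 1))) × Fin (3 + 1)) (↥(pbox (towerTorus Lc (fine Lc (Mc B)) (n + 1))) × Fin (3 + 1)) ℝ}
  (hH₀ : ∀ n : ℕ, ∀ B : ℕ, ((H₀ n) B) = (perF (towerTorus Lc (fine Lc (Mc B)) (n + 1)) (bhKStepSh 3 Lc (Dsh Lc) ((n + 1 - (n + 1))))).submatrix (fun b : (↥(pbox (towerTorus Lc (fine Lc (Mc B)) (n + 1))) × Fin (3 + 1)) => ((b.1, Sum.inl b.2) : Idx (towerTorus Lc (fine Lc (Mc B)) (n + 1)) (Fib 3))) (fun b : (↥(pbox (towerTorus Lc (fine Lc (Mc B)) (n + 1))) × Fin (3 + 1)) => ((b.1, Sum.inl b.2) : Idx (towerTorus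 Lc (fine Lc (Mc B)) (n + 1)) (Fib 3))))
  {P : ∀ n : ℕ, ∀ B : ℕ, Matrix (NParam Lc (fine Lc (Mc B)) (fun _ : ℕ => ctrOff (3 + 1) Lc) (n + 1)) (↥(pbox (towerTorus Lc (fine Lc (Mc B)) (n + 1))) × Fin (3 + 1)) ℝ}
  (hP : ∀ n : ℕ, ∀ B : ℕ, ((P n) B) = bigP Lc (fine Lc (Mc B)) (fun _ : ℕ => ctrOff (3 + 1) Lc) (fun _ => toSite_mem_range (ctrOff_mem_box (d := 3 + 1) (Nat.one_le_iff_ne_zero.mpr (NeZero.ne Lc)))) (n + 1))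
  (fN : ∀ n : ℕ, ∀ B : ℕ, (↥(pbox (Mc B)) × Fin (3 + 1)) → Idx (towerTorus Lc (fine Lc (Mc B)) (n + 1)) (Fib 3))
  (hfN : ∀ n : ℕ, ∀ B : ℕ, ∀ a : ↥(pbox (Mc B)) × Fin (3 + 1), (fN n) B a = (wrapPt (towerTorus Lc (fine Lc (Mc B)) (n + 1)) (((Lc ^ (n + 1 + 1) : ℕ) : ℤ) • (a.1 : Site (3 + 1))), Sum.inr a.2))
  {𝔔₀ : ∀ n : ℕ, ∀ B : ℕ, Matrix ((↥(pbox (Mc B)) × Fin (3 + 1))) (↥(pbox (towerTorus Lc (fine Lc (Mc B)) (n + 1))) × Fin (3 + 1)) ℝ}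
  (YN : ∀ n : ℕ, ∀ B : ℕ, Matrix ((↥(pbox (Mc B)) × Fin (3 + 1))) (NParam Lc (fine Lc (Mc B)) (fun _ : ℕ => ctrOff (3 + 1) Lc) (n + 1)) ℝ)
  (hQN' : ∀ n : ℕ, ∀ B : ℕ, ((𝔔₀ n) B) = (sn n) • (perF (towerTorus Lc (fine Lc (Mc B)) (n + 1)) (bhKcomp (d := 3) (fun _ : ℕ => ctrOff (3 + 1) Lc) Lc (n + 1 + 1))).submatrix ((fN n) B) (fun b : (↥(pbox (towerTorus Lc (fine Lc (Mc B)) (n + 1))) × Fin (3 + 1)) => ((b.1, Sum.inl b.2) : Idx (towerTorus Lc (fine Lc (Mc B)) (n + 1)) (Fib 3))) + ((YN n) B) * ((P n) B))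

include hsn hH₀ hP hfN hQN' in
/-- [folklore] **`hXN` AT THE RECORD UNDER THE SHEARED ROW JUNCTION** — v10's binder `hXN` (L.223) character for character under σ′: `TowerNSocketOfRow.hXN_rec` at the EXACT
rows `(sn n)•𝔔♭` (`hQN := rfl`), carried across the comb shear by `KktCombRowShear.rightInverse_of_shear` with `hQN′`. -/
theorem hXN_rec' :
    ∀ n : ℕ, ∀ B : ℕ, kkt ((H₀ n) B) (fromRows ((𝔔₀ n) B) ((P n) B)) * ((fromBlocks (1 : Matrix (↥(pbox (towerTorus Lc (fine Lc (Mc B)) (n + 1))) × Fin (3 + 1)) (↥(pbox (towerTorus Lc (fine Lc (Mc B)) (n + 1))) × Fin (3 + 1)) ℝ) 0 0 (fromBlocks (1 : Matrix (↥(pbox (Mc B)) × Fin (3 + 1)) (↥(pbox (Mc B)) × Fin (3 + 1)) ℝ) (-((YN n) B)) 0 (1 : Matrix (NParam Lc (fine Lc (Mc B)) (fun _ : ℕ => ctrOff (3 + 1) Lc) (n + 1)) (NParam Lc (fine Lc (Mc B)) (fun _ : ℕ => ctrOff (3 + 1) Lc) (n + 1)) ℝ)))ᵀ * XNRec Lc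 (fine Lc (Mc B)) (n + 1) (sn n) ((H₀ n) B) ((P n) B) ((fN n) B) * fromBlocks (1 : Matrix (↥(pbox (towerTorus Lc (fine Lc (Mc B)) (n + 1))) × Fin (3 + 1)) (↥(pbox (towerTorus Lc (fine Lc (Mc B)) (n + 1))) × Fin (3 + 1)) ℝ) 0 0 (fromBlocks (1 : Matrix (↥(pbox (Mc B)) × Fin (3 + 1)) (↥(pbox (Mc B)) × Fin (3 + 1)) ℝ) (-((YN n) B)) 0 (1 : Matrix (NParam Lc (fine Lc (Mc B)) (fun _ : ℕ => ctrOff (3 + 1) Lc) (n + 1)) (NParam Lc (fine Lc (Mc B)) (fun _ : ℕ => ctrOff (3 + 1) Lc) (n + 1)) ℝ))) = 1 := by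
  intro n B
  exact rightInverse_of_shear ((H₀ n) B) ((P n) B) ((YN n) B) (hQN' n B) _
    (hXN_rec Lc Mc sn hsn hH₀ hP fN hfN (𝔔₀ := fun n B => (sn n) • (perF (towerTorus Lc (fine Lc (Mc B)) (n + 1)) (bhKcomp (d := 3) (fun _ : ℕ => ctrOff (3 + 1) Lc) Lc (n + 1 + 1))).submatrix ((fN n) B) (fun b : (↥(pbox (towerTorus Lc (fine Lc (Mc B)) (n + 1))) × Fin (3 + 1)) => ((b.1, Sum.inl b.2) : Idx (towerTorus Lc (fine Lc (Mc B)) (n + 1)) (Fib 3))))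
      (fun _ _ => rfl) n B)

include hLc hH₀ hP hfN in
/-- [folklore] **`hLN` AT THE RECORD UNDER THE SHEARED ROW JUNCTION** — v10's binder `hLN` (L.229) character for character under σ′: `TowerNSocketOfRow.hLN_rec` carried across the
comb shear by `KktCombRowShear.leg_of_shear` (the leg does not see the shear; `hQN′`, `hsn`, `YN`'s value are NOT used). -/
theorem hLN_rec' :
    ∀ n : ℕ, ∀ B : ℕ, ((fromBlocks (1 : Matrix (↥(pbox (towerTorus Lc (fine Lc (Mc B)) (n + 1))) × Fin (3 + 1)) (↥(pbox (towerTorus Lc (fine Lc (Mc B)) (n + 1))) × Fin (3 + 1)) ℝ) 0 0 (fromBlocks (1 : Matrix (↥(pbox (Mc B)) × Fin (3 + 1)) (↥(pbox (Mc B)) × Fin (3 + 1)) ℝ) (-((YN n) B)) 0 (1 : Matrix (NParam Lc (fine Lc (Mc B)) (fun _ : ℕ => ctrOff (3 + 1) Lc) (n + 1)) (NParam Lc (fine Lc (Mc B)) (fun _ : ℕ => ctrOff (3 + 1) Lc) (n + 1)) ℝ)))ᵀ * XNRec Lc (fine Lc (Mc B)) (n + 1) (sn n) ((H₀ n) B)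 ((P n) B) ((fN n) B) * fromBlocks (1 : Matrix (↥(pbox (towerTorus Lc (fine Lc (Mc B)) (n + 1))) × Fin (3 + 1)) (↥(pbox (towerTorus Lc (fine Lc (Mc B)) (n + 1))) × Fin (3 + 1)) ℝ) 0 0 (fromBlocks (1 : Matrix (↥(pbox (Mc B)) × Fin (3 + 1)) (↥(pbox (Mc B)) × Fin (3 + 1)) ℝ) (-((YN n) B)) 0 (1 : Matrix (NParam Lc (fine Lc (Mc B)) (fun _ : ℕ => ctrOff (3 + 1) Lc) (n + 1)) (NParam Lc (fine Lc (Mc B)) (fun _ : ℕ => ctrOff (3 + 1) Lc) (n + 1)) ℝ))).submatrix (Sum.map id Sum.inl) (Sum.map id Sum.inl) = fromBlocks (Matrix.of fun (b b' : (↥(pbox (towerTorus Lc (fine Lc (Mc B)) (n + 1))) × Fin (3 + 1))) => axEc (ctr (3 + 1) (Lc ^ (n + 1 + 1))) (Lc ^ (n + 1 + 1)) (b.1 : Site (3 + 1)) (b.1 : Site (3 + 1)) (Sum.inl b.2) (Sum.inl b.2) * (axEc (ctr (3 + 1) (Lc ^ (n + 1 + 1))) (Lc ^ (n + 1 + 1))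 (b'.1 : Site (3 + 1)) (b'.1 : Site (3 + 1)) (Sum.inl b'.2) (Sum.inl b'.2) * perF (towerTorus Lc (fine Lc (Mc B)) (n + 1)) (scaleK (Sum.elim (fun _ : Fin (3 + 1) => (1 : ℝ)) (fun _ : Fin (3 + 1) => (sn n)⁻¹)) (Sum.elim (fun _ : Fin (3 + 1) => (1 : ℝ)) (fun _ : Fin (3 + 1) => (sn n)⁻¹)) (AN (Roots.ctr Lc) (n + 1))) (b.1, Sum.inl b.2) (b'.1, Sum.inl b'.2))) (Matrix.of fun (b : (↥(pbox (towerTorus Lc (fine Lc (Mc B)) (n + 1))) × Fin (3 + 1))) (a : (↥(pbox (Mc B)) × Fin (3 + 1))) => axEc (ctr (3 + 1) (Lc ^ (n + 1 + 1))) (Lc ^ (n + 1 + 1)) (b.1 : Site (3 + 1)) (b.1 : Site (3 + 1)) (Sum.inl b.2) (Sum.inl b.2) * perF (towerTorus Lc (fine Lc (Mc B)) (n + 1)) (scaleK (Sum.elim (fun _ : Fin (3 + 1) => (1 : ℝ)) (fun _ : Fin (3 + 1) => (sn n)⁻¹)) (Sum.elim (fun _ : Fin (3 + 1) => (1 : ℝ))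 (fun _ : Fin (3 + 1) => (sn n)⁻¹)) (AN (Roots.ctr Lc) (n + 1))) (b.1, Sum.inl b.2) (((fN n) B) a)) (-Matrix.of fun (a : (↥(pbox (Mc B)) × Fin (3 + 1))) (b : (↥(pbox (towerTorus Lc (fine Lc (Mc B)) (n + 1))) × Fin (3 + 1))) => axEc (ctr (3 + 1) (Lc ^ (n + 1 + 1))) (Lc ^ (n + 1 + 1)) (b.1 : Site (3 + 1)) (b.1 : Site (3 + 1)) (Sum.inl b.2) (Sum.inl b.2) * perF (towerTorus Lc (fine Lc (Mc B)) (n + 1)) (scaleK (Sum.elim (fun _ : Fin (3 + 1) => (1 : ℝ)) (fun _ : Fin (3 + 1) => (sn n)⁻¹)) (Sum.elim (fun _ : Fin (3 + 1) => (1 : ℝ)) (fun _ : Fin (3 + 1) => (sn n)⁻¹)) (AN (Roots.ctr Lc) (n + 1))) (((fN n) B) a) (b.1, Sum.inl b.2)) (-((perF (towerTorus Lc (fine Lc (Mc B)) (n + 1)) (scaleK (Sum.elim (fun _ : Fin (3 + 1) => (1 : ℝ)) (fun _ : Fin (3 + 1) => (sn n)⁻¹)) (Sum.elim (fun _ : Fin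 (3 + 1) => (1 : ℝ)) (fun _ : Fin (3 + 1) => (sn n)⁻¹)) (AN (Roots.ctr Lc) (n + 1)))).submatrix ((fN n) B) ((fN n) B))) := by
  intro n B
  exact leg_of_shear ((YN n) B) _ (hLN_rec Lc hLc Mc sn hH₀ hP fN hfN n B)

end Summit.QuantumFields.BalabanUV.Beta.FP.TowerNSocketOfRowShear

end
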